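import Summits.HodgeConjecture.HodgeConjecture.Theses.ELineTransport
import Summits.HodgeConjecture.HodgeConjecture.Theorems.NikulinTwinTransportSquareHodgeOfSqrtTwoOfKunneth
import Summits.HodgeConjecture.HodgeConjecture.Theorems.NikulinTwinTransportRealMultiplicationOfHodgeConjecture
import Summits.HodgeConjecture.HodgeConjecture.Theorems.NikulinTwinTransportLefschetzOneOneK3Closing
import Literature.AlgebraicGeometry.HodgeTheory.GysinBaseChange
import Literature.AlgebraicGeometry.Surfaces.K3Marking

/-!
# Birth skeleton — `ELineTransport.SquareHodgeOfEClass` (stmt-HodgeConjecture-19047), piece X₁ of the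
# BC2 redirect of `IsogenyInvariance` (stmt-HodgeConjecture-12550)

LINE `birth` (crux-strategist): Künneth bookkeeping under EX. The sibling route's LANDED Künneth
engine `Theorems.NikulinTwinTransport.kunnethCriterion_of_kunneth` gives `HodgeConjectureFor 4 (S ⊗ S)`
for a projective K3 surface `S` from the Künneth criterion (K) "every rational type-preserving
endomorphism of `H²(S(ℂ); ℂ)` is `[γ]_*` with `γ` algebraic" and Lefschetz `(1,1)` for `S` (landed:
`Theorems.lefschetzOneOneK3_proof`), granted the standard inputs — Künneth spanning
(`kunnethSpan_complexBetti`, proved), Hodge models (`nonempty_hodgeModel_holds`), multiplicativity of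
Hodge types (`cupPreservesHodgeType_of_nonempty_hodgeModel`, from de Rham's theorem), `b₁ = 0` and
markings. Three stubs remain:

* `stub_kunnethCriterion_of_EX` — (K) UNDER EX: with `id = [Δ]_*` (`id_induced_by_diagonal`), `J = [γ_J]_*`
  (hypothesis) and EX, every rational type-preserving `G` is `a + bJ + φ` with `φ` killing
  `T = NS^⊥` modulo `NS` — in fact killing `T` (a rational subspace whose complexification contains
  `σ` contains `T`, by Lefschetz `(1,1)` and non-degeneracy) and mapping `NS → NS`, so `φ` is a
  ℚ-combination of rank-one divisor maps `x ↦ (x.d′) d`, each `[pr₁^* d ∪ pr₂^* d′]_*` up to the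
  fibre-integration scalar (`divisorCorrespondence_of_fibreIntegral`, `fibreIntegral_square_of_kunneth`,
  landed); `J` preserving types (`EClassOfSquareHodge/Lines/birth.lean`, `stub_typePreserving_of_EStructure`)
  makes `φ` type-preserving;
* `stub_K3_marking` — the named fact `Huybrechts_K3_marking_exists`;
* `stub_K3_b1` — `b₁ = 0` for projective K3 surfaces (named fact `Huybrechts_K3_oddBetti_vanish`,
  discharged in tree from `H¹(S, 𝒪) = 0` modulo the Dolbeault comparison).

`SquareHodgeOfEClass_of` is the kernel-checked composition.
-/

namespace Summit.HodgeConjecture.HodgeConjecture.Cruxes.SquareHodgeOfEClass.Birth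

set_option linter.dupNamespace false

open scoped Manifold
open CategoryTheory AlgebraicGeometry MonoidalCategory
open Literature.AlgebraicGeometry.Motives Literature.AlgebraicGeometry.HodgeTheory
open Literature.AlgebraicGeometry.Surfaces
open Literature.AlgebraicTopology.SingularHomology
open Summit.HodgeConjecture.HodgeConjecture.Theses.ELineTransport

/-- STUB (M–L): **the Künneth criterion (K) under EX.** For a projective K3 surface `S`, a non-square
`m`, an E-structure `J` (rational, `J ∘ J = m`, cup-self-adjoint, `+√m` on `H^{2,0}`) satisfying EX
whose class is induced by an algebraic class `γ_J` on `S ⊗ S`, EVERY rational type-preserving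
endomorphism `G` of `H²(S(ℂ); ℂ)` is induced by an algebraic class of codimension `2` on `S ⊗ S`
(`G = a·[Δ]_* + b·[γ_J]_* + Σ qᵢ·[pr₁^* dᵢ ∪ pr₂^* dᵢ′]_*`). [cite: Varesco2023, §2 (p. 8)]
[cite: Huybrechts2016K3, Ch. 3 §3] [cite: VoisinHodgeII2003, proof of Thm. 10.17 (10.7)] -/
theorem stub_kunnethCriterion_of_EX :
    ∀ (μ : OrientationFamily), μ.HasPoincareDuality → ∀ (S : SchemeOver ℂ)
      (hS : (IsSmoothProjective 2 S ∧ Subsingleton (structureSheafCohomology S.left 1) ∧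
        ∃ (A : HodgeModel 2 S) (η : Literature.Geometry.Kaehler.MForm 𝓘(ℝ, A.model) A.carrier ℂ 2),
          Literature.Geometry.Kaehler.IsHolomorphicInCharts η ∧ ∀ x, η x ≠ 0)),
      ∀ m : ℕ, ¬ IsSquare m → ∀ J : complexBetti S 2 →ₗ[ℂ] complexBetti S 2,
        ((∀ c, IsRationalClass c → IsRationalClass (J c)) ∧ (∀ c, J (J c) = (m : ℂ) • c) ∧
          (∀ a b, cupProduct rfl (J a) b = cupProduct rfl a (J b)) ∧
          (∀ c, IsOfHodgeType 2 S 2 2 0 c → J c = (Real.sqrt m : ℂ) • c)) →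
        (∀ ψ : complexBetti S 2 →ₗ[ℂ] complexBetti S 2, (∀ c, IsRationalClass c → IsRationalClass (ψ c)) →
          (∀ p q c, IsOfHodgeType 2 S 2 p q c → IsOfHodgeType 2 S 2 p q (ψ c)) → ∃ a b : ℚ, ∀ v,
            (∀ w ∈ algebraicClasses S 1, cupProduct rfl v w = 0) →
              ψ v - ((a : ℂ) • v + (b : ℂ) • J v) ∈ algebraicClasses S 1) →
        (∃ γ ∈ algebraicClasses (S ⊗ S) 2, ∀ x : complexBetti S 2,
          J x = complexGysin μ (IsSmoothProjective.tensor_holds hS.1 hS.1) hS.1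
            (SemiCartesianMonoidalCategory.fst S S) (rfl : 2 + 2 * 2 + 2 * 2 = 2 + 2 * (2 + 2))
            (cupProduct (rfl : 2 + 2 * 2 = 2 + 2 * 2)
              (complexBetti.map (SemiCartesianMonoidalCategory.snd S S) 2 x) γ)) →
        ∀ G : complexBetti S 2 →ₗ[ℂ] complexBetti S 2,
          (∀ x, IsRationalClass x → IsRationalClass (G x)) →
          (∀ (i j : ℕ) x, IsOfHodgeType 2 S 2 i j x → IsOfHodgeType 2 S 2 i j (G x)) →
          ∃ γ ∈ algebraicClasses (S ⊗ S) 2, ∀ x : complexBetti S 2,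
            G x = complexGysin μ (IsSmoothProjective.tensor_holds hS.1 hS.1) hS.1
              (SemiCartesianMonoidalCategory.fst S S) (rfl : 2 + 2 * 2 + 2 * 2 = 2 + 2 * (2 + 2))
              (cupProduct (rfl : 2 + 2 * 2 = 2 + 2 * 2)
                (complexBetti.map (SemiCartesianMonoidalCategory.snd S S) 2 x) γ) := by
  sorry

/-- STUB (named fact, L): markings of projective K3 surfaces exist (`Huybrechts_K3_marking_exists`,
Huybrechts Ch. 1 Prop. 3.5). [cite: Huybrechts2016K3, Ch. 1 Prop. 3.5] -/
theorem stub_K3_marking : Huybrechts_K3_marking_exists := by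
  sorry

/-- STUB (named fact, M): `b₁ = 0` for projective K3 surfaces — `H¹(S(ℂ); ℂ) = 0` (Huybrechts Ch. 1
§3.2; in tree `Huybrechts_K3_oddBetti_vanish`, reduced to the Dolbeault comparison in
`K3BettiNumbersOfGAGA`). [cite: Huybrechts2016K3, Ch. 1 §3.2] -/
theorem stub_K3_b1 :
    ∀ (S : SchemeOver ℂ), IsK3Surface S → Subsingleton (complexBetti S 1) := by
  sorry

/-- **X₁ from the three stubs**: Künneth bookkeeping under EX — the sibling engine
`kunnethCriterion_of_kunneth` fed with (K) from `stub_kunnethCriterion_of_EX`, Lefschetz `(1,1)`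
(`lefschetzOneOneK3_proof`) and the standard inputs. [cite: Varesco2023, §2 (p. 8)]
[cite: VoisinHodgeI2002, §11.3.3 Lemma 11.41] [cite: Deligne2000, §1] -/
theorem SquareHodgeOfEClass_of
    (hK : ∀ (μ : OrientationFamily), μ.HasPoincareDuality → ∀ (S : SchemeOver ℂ)
      (hS : (IsSmoothProjective 2 S ∧ Subsingleton (structureSheafCohomology S.left 1) ∧
        ∃ (A : HodgeModel 2 S) (η : Literature.Geometry.Kaehler.MForm 𝓘(ℝ, A.model) A.carrier ℂ 2),
          Literature.Geometry.Kaehler.IsHolomorphicInCharts η ∧ ∀ x, η x ≠ 0)),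
      ∀ m : ℕ, ¬ IsSquare m → ∀ J : complexBetti S 2 →ₗ[ℂ] complexBetti S 2,
        ((∀ c, IsRationalClass c → IsRationalClass (J c)) ∧ (∀ c, J (J c) = (m : ℂ) • c) ∧
          (∀ a b, cupProduct rfl (J a) b = cupProduct rfl a (J b)) ∧
          (∀ c, IsOfHodgeType 2 S 2 2 0 c → J c = (Real.sqrt m : ℂ) • c)) →
        (∀ ψ : complexBetti S 2 →ₗ[ℂ] complexBetti S 2, (∀ c, IsRationalClass c → IsRationalClass (ψ c)) →
          (∀ p q c, IsOfHodgeType 2 S 2 p q c → IsOfHodgeType 2 S 2 p q (ψ c)) → ∃ a b : ℚ, ∀ v,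
            (∀ w ∈ algebraicClasses S 1, cupProduct rfl v w = 0) →
              ψ v - ((a : ℂ) • v + (b : ℂ) • J v) ∈ algebraicClasses S 1) →
        (∃ γ ∈ algebraicClasses (S ⊗ S) 2, ∀ x : complexBetti S 2,
          J x = complexGysin μ (IsSmoothProjective.tensor_holds hS.1 hS.1) hS.1
            (SemiCartesianMonoidalCategory.fst S S) (rfl : 2 + 2 * 2 + 2 * 2 = 2 + 2 * (2 + 2))
            (cupProduct (rfl : 2 + 2 * 2 = 2 + 2 * 2)
              (complexBetti.map (SemiCartesianMonoidalCategory.snd S S) 2 x) γ)) →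
        ∀ G : complexBetti S 2 →ₗ[ℂ] complexBetti S 2,
          (∀ x, IsRationalClass x → IsRationalClass (G x)) →
          (∀ (i j : ℕ) x, IsOfHodgeType 2 S 2 i j x → IsOfHodgeType 2 S 2 i j (G x)) →
          ∃ γ ∈ algebraicClasses (S ⊗ S) 2, ∀ x : complexBetti S 2,
            G x = complexGysin μ (IsSmoothProjective.tensor_holds hS.1 hS.1) hS.1
              (SemiCartesianMonoidalCategory.fst S S) (rfl : 2 + 2 * 2 + 2 * 2 = 2 + 2 * (2 + 2))
              (cupProduct (rfl : 2 + 2 * 2 = 2 + 2 * 2)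
                (complexBetti.map (SemiCartesianMonoidalCategory.snd S S) 2 x) γ))
    (hmark : Huybrechts_K3_marking_exists)
    (hb₁ : ∀ (S : SchemeOver ℂ), IsK3Surface S → Subsingleton (complexBetti S 1)) :
    SquareHodgeOfEClass := by
  intro μ hμ S hS m hm J hJ hEX hγJ
  have hcupT : ∀ (n : ℕ) (X : SchemeOver ℂ), IsSmoothProjective n X → CupPreservesHodgeType n X :=
    fun n X hX ↦ cupPreservesHodgeType_of_nonempty_hodgeModel hodgePQ_independent_of_hodgeModel_holds
      nonempty_hodgeModel_holds
      (fun E _ _ _ ↦ Literature.NumberTheory.Transcendental.exists_deRhamIsoFamily_holds (E := E)) hX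
  exact Theorems.NikulinTwinTransport.kunnethCriterion_of_kunneth
    (fun _ _ _ _ hY hZ k z ↦ kunnethSpan_complexBetti hY hZ k z) hb₁ (fun _ _ ↦ nonempty_hodgeModel_holds)
    hcupT hmark μ hμ S hS (hK μ hμ S hS m hm J hJ hEX hγJ) (Theorems.lefschetzOneOneK3_proof S hS)

/-- The composition in registered-stub form. -/
theorem SquareHodgeOfEClass_of_stubs : SquareHodgeOfEClass :=
  SquareHodgeOfEClass_of stub_kunnethCriterion_of_EX stub_K3_marking stub_K3_b1

end Summit.HodgeConjecture.HodgeConjecture.Cruxes.SquareHodgeOfEClass.Birth
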